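import Literature.NumberTheory.IwasawaTheory.ClassicalMuVanishesQuarticOverQuadraticTwo
import Literature.NumberTheory.IwasawaTheory.ClassicalMuVanishesPExtensionAscentOdd
import HarnessLib

/-!
# `μ₂ = 0` ascends EVERY finite Galois `2`-power extension `K'/K` of a TOTALLY COMPLEX number field `K` (Iwasawa 1973, Thm. 3 at `ℓ = 2`,
# iterated along a normal series), and every TOTALLY REAL one (Thm. 2, nothing ramified at infinity) — proved; no definition, no named fact

`Proofs`-style file (theorems only, no `sorry`) in topic `NumberTheory/IwasawaTheory` (namespace `Literature.NumberTheory.IwasawaTheory`), written by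
the prover seat `bsd-line-att-p3` g35 (cell `bsd-f1-sign2`, route `AlignedTransportAtTwo`, `--supports` stmt-BirchSwinnertonDyer-22298; closes nothing;
nothing about elliptic curves or BSD is asserted here).  It is the `ℓ = 2` twin of cell bsd-potss's `ClassicalMuVanishesPExtensionAscentOdd`
(`p` odd), which the archimedean obstruction had left open: for `ℓ = 2` a quadratic step `K ⊆ M` may ramify at real places, and then Chevalley's
formula carries a unit-signature / narrow-class-number term.  Iwasawa's Thm. 3 avoids it by asking the base to be TOTALLY IMAGINARY («`k` totally
imaginary if `l = 2`»): every field above `K` is then totally complex and no archimedean place ramifies anywhere in the tower; dually, if the TOP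
field `K'` is totally real, every intermediate step is totally real over totally real and again nothing ramifies at infinity (Thm. 2, proof pp. 7–8).
This seat's g34 files proved the two signature-free QUADRATIC steps (`classicalMu_of_sq_eq_of_isTotallyComplex` / `…_of_isTotallyReal`,
`ClassicalMuVanishesQuadraticAscentIntrinsic`); here they are (§1) freed of the explicit square-root generator and (§2–§3) iterated along a normal
series of the `2`-group `Gal(K'/K)` (a subgroup of index `2` is normal), exactly as in the odd file.

* §0 `exists_integral_sqrt_generator_of_finrank_eq_two` — `[K' : K] = 2` ⟹ `K' = K[x]` with `x ∈ 𝓞_{K'}`, `x² = m ∈ 𝓞_K ∖ 0`.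
* §1 generator-free quadratic steps, restricted form (`κ` the cyclotomic `ℤ₂`-extension of `ℚ`, `κ ∘ res` onto for `K`, `K'`):
  `classicalMuVanishes_restrict_rat_of_finrank_eq_two_of_isTotallyComplex` (`K` totally complex) and `…_of_isTotallyReal` (`K'` totally real).
* §2 ★★ **`classicalMuVanishes_restrict_rat_of_isGalois_of_finrank_eq_two_pow_of_isTotallyComplex`** — `K ⊆ K'`, `K'/K` GALOIS of degree `2^m`,
  `K` TOTALLY COMPLEX, `κ ∘ res` onto for both: `ClassicalMuVanishes (κ|_K) ⟹ ClassicalMuVanishes (κ|_{K'})`; and the totally-real twin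
  `…_of_isTotallyReal` (`K'` totally real).
* §3 intrinsic forms (every cyclotomic `ℤ₂`-extension; the proviso «`√2 ∉ K'`», i.e. `K' ∩ ℚ_∞ = ℚ`, is what the tree's restricted currency needs):
  ★★ **`classicalMu_of_isGalois_of_finrank_eq_two_pow_of_isTotallyComplex`**, **`…_of_isTotallyReal`**, and over `ℚ`:
  `classicalMuVanishes_of_isGalois_rat_of_finrank_eq_two_pow_of_isTotallyReal` (every TOTALLY REAL Galois number field of `2`-power degree not
  containing `√2` has `μ₂ = 0` for every cyclotomic `ℤ₂`-extension — base `μ₂(ℚ) = 0`, Iwasawa 1956).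
The general Galois `2`-power extension of `ℚ` (Iwasawa 1973 §4, case `l = 2`: pass to `k(√−1) ⊇ ℚ(√−1)` and descend) is the sequel file
`ClassicalMuVanishesTwoPowerGaloisRat`.

HONEST SCOPE.  Elementary given the quadratic steps; Iwasawa's Thm. 3 is stated for one Galois `ℓ`-power step with the «finitely decomposed» proviso,
automatic for cyclotomic towers (his Thm. 3 proper); the kernel statements carry the linear-disjointness proviso of the tree's currency.  In print for all
`2`-power Galois extensions of `ℚ` (Iwasawa 1973 §4) and, for abelian fields, Ferrero–Washington; the point is a fact-free kernel proof.

References: [Iwasawa1973MuInvariants] Thm. 2 (and its proof, pp. 7–8), Thm. 3, §4; [Washington1997] §13.3 Prop. 13.23; [Lang1990] Ch. 13 §4.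
-/

set_option autoImplicit false

noncomputable section

open scoped NumberField Classical
open NumberField Field IntermediateField IsDedekindDomain Module

namespace Literature.NumberTheory.IwasawaTheory

open Literature.NumberTheory.EllipticCurves Literature.NumberTheory.EllipticCurves.ZpExtension
  Literature.NumberTheory.GaloisRepresentations Literature.NumberTheory.NumberFields
  Literature.NumberTheory.QuadraticFields

/-! ## §0 An integral square-root generator for a quadratic step -/

/-- **Every quadratic step of number fields has an integral square-root generator**: `[K' : K] = 2` ⟹ there are `x ∈ 𝓞_{K'}` and
`m ∈ 𝓞_K ∖ 0` with `x² = m` and `K' = K[x]` (a square-root generator `θ`, `θ² = c ∈ K`, times an integer clearing denominators).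
[cite: Washington1997, §13.3 (proof of Prop. 13.23)] -/
theorem exists_integral_sqrt_generator_of_finrank_eq_two (K K' : Type) [Field K] [NumberField K] [Field K'] [NumberField K']
    [Algebra K K'] (hdeg : Module.finrank K K' = 2) :
    ∃ (x : 𝓞 K') (m : 𝓞 K), m ≠ 0 ∧ x ^ 2 = algebraMap (𝓞 K) (𝓞 K') m ∧ Algebra.adjoin K {(x : K')} = ⊤ := by
  haveI : FiniteDimensional K K' := Module.finite_of_finrank_eq_succ hdeg
  obtain ⟨θ, c, hθK, hθc⟩ := Quadratic.exists_sq_eq_algebraMap (F := K) (K := K') hdeg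
  have halg : IsAlgebraic ℤ θ := (IsFractionRing.isAlgebraic_iff ℤ ℚ K').mpr (Algebra.IsAlgebraic.isAlgebraic θ)
  obtain ⟨n, hn0, hnint⟩ := halg.exists_integral_multiple
  set y : 𝓞 K' := ⟨n • θ, hnint⟩ with hydef
  have hyval : ((y : 𝓞 K') : K') = (n : K') * θ := by rw [hydef]; simp [zsmul_eq_mul]
  have hysq : ((y : 𝓞 K') : K') ^ 2 = algebraMap K K' ((n : K) ^ 2 * c) := by
    rw [hyval, mul_pow, hθc, map_mul, map_pow, map_intCast]
  have hmint : IsIntegral ℤ ((n : K) ^ 2 * c) := by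
    have h1 : IsIntegral ℤ (((y : 𝓞 K') : K') ^ 2) := y.isIntegral_coe.pow 2
    rw [hysq] at h1
    exact (isIntegral_algHom_iff (IsScalarTower.toAlgHom ℤ K K') (algebraMap K K').injective).mp h1
  set m : 𝓞 K := ⟨(n : K) ^ 2 * c, hmint⟩ with hmdef
  have hc0 : c ≠ 0 := by
    intro h0
    apply hθK
    refine ⟨0, ?_⟩
    have : θ ^ 2 = 0 := by rw [hθc, h0, map_zero]
    rw [map_zero]
    exact ((pow_eq_zero_iff two_ne_zero).mp this).symm
  have hm : m ≠ 0 := by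
    intro h0
    have : (n : K) ^ 2 * c = 0 := by
      have := congrArg (fun t : 𝓞 K ↦ (t : K)) h0
      simpa [hmdef] using this
    rcases mul_eq_zero.mp this with h | h
    · exact hn0 (by exact_mod_cast (pow_eq_zero_iff two_ne_zero).mp h)
    · exact hc0 h
  have hy2 : y ^ 2 = algebraMap (𝓞 K) (𝓞 K') m := by
    apply RingOfIntegers.ext
    change ((y : 𝓞 K') : K') ^ 2 = algebraMap K K' ((m : 𝓞 K) : K)
    rw [hysq]
    rfl
  have hyK : ((y : 𝓞 K') : K') ∉ Set.range (algebraMap K K') := by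
    rintro ⟨t, ht⟩
    apply hθK
    refine ⟨(n : K)⁻¹ * t, ?_⟩
    have hn0' : (n : K') ≠ 0 := by exact_mod_cast hn0
    rw [map_mul, map_inv₀, map_intCast, ht, hyval]
    field_simp
  have hgen : Algebra.adjoin K {((y : 𝓞 K') : K')} = ⊤ := by
    have hy'int : IsIntegral K ((y : 𝓞 K') : K') := IsIntegral.of_finite _ _
    have hdeg2 : Module.finrank K ↥K⟮((y : 𝓞 K') : K')⟯ = 2 :=
      finrank_adjoin_simple_eq_two_of_sq_eq (a := (n : K) ^ 2 * c) hysq hyK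
    have htop : K⟮((y : 𝓞 K') : K')⟯ = ⊤ :=
      IntermediateField.eq_of_le_of_finrank_eq le_top (by rw [hdeg2, IntermediateField.finrank_top', hdeg])
    rw [← IntermediateField.adjoin_simple_toSubalgebra_of_isAlgebraic hy'int.isAlgebraic, htop, IntermediateField.top_toSubalgebra]
  exact ⟨y, m, hm, hy2, hgen⟩

/-! ## §1 Generator-free quadratic steps (restricted form) -/

/-- A totally complex number field has no ring morphism to `ℝ`. [folklore] -/
private theorem false_of_ringHom_real₂ {K : Type} [Field K] [NumberField K] [IsTotallyComplex K] (ρ : K →+* ℝ) : False := by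
  have h : ComplexEmbedding.IsReal (Complex.ofRealHom.comp ρ) := by
    rw [ComplexEmbedding.isReal_iff]
    ext x
    simp [ComplexEmbedding.conjugate_coe_eq]
  exact IsTotallyComplex.complexEmbedding_not_isReal _ h

/-- **Quadratic step over a TOTALLY COMPLEX base, restricted form, no explicit generator** (Iwasawa 1973 Thm. 3, one step): `κ` the cyclotomic
`ℤ₂`-extension of `ℚ`, `K ⊆ K'` number fields with `[K' : K] = 2`, `K` totally complex, `κ ∘ res` onto for both:
`ClassicalMuVanishes (κ|_K) ⟹ ClassicalMuVanishes (κ|_{K'})` (cell bsd-2adic's `classicalMuVanishes_restrict_rat_of_sq_eq` on the generator of §0;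
`K'` is totally complex and `K` has no real embedding, so the signature hypothesis is vacuous). [cite: Iwasawa1973MuInvariants, Thm. 3]
[cite: Washington1997, §13.3 Prop. 13.23] -/
theorem classicalMuVanishes_restrict_rat_of_finrank_eq_two_of_isTotallyComplex (κ : ZpExtension ℚ 2) (hκ : κ.IsCyclotomic)
    (K K' : Type) [Field K] [NumberField K] [Field K'] [NumberField K'] [Algebra K K'] [IsTotallyComplex K]
    (hdeg : Module.finrank K K' = 2)
    (hK : Function.Surjective (κ.toContinuousMonoidHom.comp (absGaloisRestrict ℚ K)))
    (hK' : Function.Surjective (κ.toContinuousMonoidHom.comp (absGaloisRestrict ℚ K')))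
    (hμ : ClassicalMuVanishes (κ.restrict K hK)) :
    ClassicalMuVanishes (κ.restrict K' hK') := by
  haveI : Fact (Nat.Prime 2) := ⟨Nat.prime_two⟩
  haveI : IsTotallyComplex K' := isTotallyComplex_of_algebra (F := K) K'
  haveI : Subsingleton (K →+* ℝ) := ⟨fun φ _ ↦ (false_of_ringHom_real₂ φ).elim⟩
  obtain ⟨x, m, hm, hx, hgen⟩ := exists_integral_sqrt_generator_of_finrank_eq_two K K' hdeg
  exact classicalMuVanishes_restrict_rat_of_sq_eq κ hκ K K' hdeg hm hx hgen hK hK' hμ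

/-- **Quadratic step with TOTALLY REAL top field, restricted form, no explicit generator** (Iwasawa 1973 Thm. 2, proof pp. 7–8: nothing ramifies
at infinity): `κ` the cyclotomic `ℤ₂`-extension of `ℚ`, `K ⊆ K'` with `[K' : K] = 2`, `K'` totally real, `κ ∘ res` onto for both:
`ClassicalMuVanishes (κ|_K) ⟹ ClassicalMuVanishes (κ|_{K'})`. [cite: Iwasawa1973MuInvariants, Thm. 2 and its proof (pp. 7–8)]
[cite: Washington1997, §13.3 Prop. 13.23] -/
theorem classicalMuVanishes_restrict_rat_of_finrank_eq_two_of_isTotallyReal (κ : ZpExtension ℚ 2) (hκ : κ.IsCyclotomic)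
    (K K' : Type) [Field K] [NumberField K] [Field K'] [NumberField K'] [Algebra K K'] [IsTotallyReal K']
    (hdeg : Module.finrank K K' = 2)
    (hK : Function.Surjective (κ.toContinuousMonoidHom.comp (absGaloisRestrict ℚ K)))
    (hK' : Function.Surjective (κ.toContinuousMonoidHom.comp (absGaloisRestrict ℚ K')))
    (hμ : ClassicalMuVanishes (κ.restrict K hK)) :
    ClassicalMuVanishes (κ.restrict K' hK') := by
  obtain ⟨x, m, hm, hx, hgen⟩ := exists_integral_sqrt_generator_of_finrank_eq_two K K' hdeg
  exact classicalMuVanishes_restrict_rat_of_sq_eq_of_isTotallyReal κ hκ K K' hdeg hm hx hgen hK hK' hμ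

/-! ## §2 The `2`-power Galois ascent (restricted form) -/

/-- ★★ **`μ₂ = 0` ascends every finite GALOIS `2`-POWER extension of a TOTALLY COMPLEX base** (Iwasawa 1973 Thm. 3 at `ℓ = 2`, iterated).
`κ` the cyclotomic `ℤ₂`-extension of `ℚ`; for every `m` and all number fields `K ⊆ K'` with `K` TOTALLY COMPLEX, `K'/K` Galois of degree `2^m`,
`κ ∘ res` onto for `K` and `K'`: **`ClassicalMuVanishes (κ|_K) ⟹ ClassicalMuVanishes (κ|_{K'})`**.  Induction on `m`: the `2`-group `Gal(K'/K)` has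
a subgroup `H` of order `2^m` (Sylow), of index `2`, hence normal; `M = K'^H` is quadratic over `K` (§1 step, `K` totally complex) and `K'/M` is
Galois of degree `2^m` with `M` totally complex. [cite: Iwasawa1973MuInvariants, Thm. 3] [cite: Washington1997, §13.3 Prop. 13.23] -/
theorem classicalMuVanishes_restrict_rat_of_isGalois_of_finrank_eq_two_pow_of_isTotallyComplex {κ : ZpExtension ℚ 2}
    (hκ : κ.IsCyclotomic) :
    ∀ (m : ℕ) (K K' : Type) [Field K] [NumberField K] [Field K'] [NumberField K'] [Algebra K K']
      [IsScalarTower ℚ K K'] [IsGalois K K'] [IsTotallyComplex K], Module.finrank K K' = 2 ^ m →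
      ∀ (hK : Function.Surjective (κ.toContinuousMonoidHom.comp (absGaloisRestrict ℚ K)))
        (hK' : Function.Surjective (κ.toContinuousMonoidHom.comp (absGaloisRestrict ℚ K'))),
        ClassicalMuVanishes (κ.restrict K hK) → ClassicalMuVanishes (κ.restrict K' hK') := by
  haveI : Fact (Nat.Prime 2) := ⟨Nat.prime_two⟩
  intro m
  induction m with
  | zero =>
    intro K K' _ _ _ _ _ _ _ _ hdeg hK hK' hμ
    haveI : FiniteDimensional K K' := Module.Finite.of_restrictScalars_finite ℚ K K'
    have hsurj : Function.Surjective (algebraMap K K') := fun x => by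
      have hx : x ∈ (⊥ : Subalgebra K K') := by
        rw [Subalgebra.bot_eq_top_of_finrank_eq_one (by rw [hdeg, pow_zero])]; exact Algebra.mem_top
      exact Algebra.mem_bot.mp hx
    let φ : K ≃ₐ[ℚ] K' :=
      AlgEquiv.ofBijective (IsScalarTower.toAlgHom ℚ K K') ⟨(algebraMap K K').injective, hsurj⟩
    exact (classicalMuVanishes_restrict_iff_of_algEquiv κ φ hK hK').mp hμ
  | succ m ih =>
    intro K K' _ _ _ _ _ _ _ _ hdeg hK hK' hμ
    haveI : FiniteDimensional K K' := Module.Finite.of_restrictScalars_finite ℚ K K'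
    -- a normal subgroup of index `2`
    have hcardG : Nat.card (K' ≃ₐ[K] K') = 2 ^ (m + 1) := by rw [IsGalois.card_aut_eq_finrank, hdeg]
    obtain ⟨H, hH⟩ := Sylow.exists_subgroup_card_pow_prime 2 (n := m) (G := K' ≃ₐ[K] K')
      (by rw [hcardG]; exact pow_dvd_pow 2 (Nat.le_succ m))
    have hindex : H.index = 2 := by
      have h1 := H.index_mul_card
      rw [hH, hcardG, pow_succ, mul_comm (2 ^ m) 2] at h1
      exact Nat.eq_of_mul_eq_mul_right (pow_pos two_pos m) h1
    haveI : H.Normal := Subgroup.normal_of_index_eq_two hindex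
    -- the intermediate field `M = K'^H`, totally complex
    set M : IntermediateField K K' := IntermediateField.fixedField H with hM
    haveI : NumberField ↥M := NumberField.of_module_finite K ↥M
    haveI : IsScalarTower ℚ K ↥M := IsScalarTower.of_algebraMap_eq' (Subsingleton.elim _ _)
    haveI : IsScalarTower ℚ ↥M K' := IsScalarTower.of_algebraMap_eq' (Subsingleton.elim _ _)
    haveI : IsGalois ↥M K' := IsGalois.tower_top_of_isGalois K ↥M K'
    haveI : IsTotallyComplex ↥M := isTotallyComplex_of_algebra (F := K) ↥M
    have hMK' : Module.finrank ↥M K' = 2 ^ m := by rw [hM, IntermediateField.finrank_fixedField_eq_card, hH]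
    have hKM : Module.finrank K ↥M = 2 := by
      have h1 := Module.finrank_mul_finrank K ↥M K'
      rw [hMK', hdeg, pow_succ, mul_comm (2 ^ m) 2] at h1
      exact Nat.eq_of_mul_eq_mul_right (pow_pos two_pos m) h1
    have hMs : Function.Surjective (κ.toContinuousMonoidHom.comp (absGaloisRestrict ℚ ↥M)) :=
      surjective_comp_absGaloisRestrict_of_tower κ ↥M K' hK'
    -- the quadratic step `K ⊆ M`, then the induction hypothesis for `M ⊆ K'`
    have hμM : ClassicalMuVanishes (κ.restrict ↥M hMs) :=
      classicalMuVanishes_restrict_rat_of_finrank_eq_two_of_isTotallyComplex κ hκ K ↥M hKM hK hMs hμ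
    exact ih ↥M K' hMK' hMs hK' hμM

/-- ★★ **`μ₂ = 0` ascends every finite GALOIS `2`-POWER extension with TOTALLY REAL top field** (Iwasawa 1973 Thm. 2 iterated; nothing ramifies at
infinity anywhere in the normal series).  `κ` the cyclotomic `ℤ₂`-extension of `ℚ`; `K ⊆ K'` number fields with `K'` TOTALLY REAL, `K'/K` Galois
of degree `2^m`, `κ ∘ res` onto for both: **`ClassicalMuVanishes (κ|_K) ⟹ ClassicalMuVanishes (κ|_{K'})`** (every intermediate field is totally
real). [cite: Iwasawa1973MuInvariants, Thm. 2 and its proof (pp. 7–8)] [cite: Greenberg1976TotallyReal, §1] [cite: Washington1997, §13.3 Prop. 13.23] -/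
theorem classicalMuVanishes_restrict_rat_of_isGalois_of_finrank_eq_two_pow_of_isTotallyReal {κ : ZpExtension ℚ 2}
    (hκ : κ.IsCyclotomic) :
    ∀ (m : ℕ) (K K' : Type) [Field K] [NumberField K] [Field K'] [NumberField K'] [Algebra K K']
      [IsScalarTower ℚ K K'] [IsGalois K K'] [IsTotallyReal K'], Module.finrank K K' = 2 ^ m →
      ∀ (hK : Function.Surjective (κ.toContinuousMonoidHom.comp (absGaloisRestrict ℚ K)))
        (hK' : Function.Surjective (κ.toContinuousMonoidHom.comp (absGaloisRestrict ℚ K'))),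
        ClassicalMuVanishes (κ.restrict K hK) → ClassicalMuVanishes (κ.restrict K' hK') := by
  haveI : Fact (Nat.Prime 2) := ⟨Nat.prime_two⟩
  intro m
  induction m with
  | zero =>
    intro K K' _ _ _ _ _ _ _ _ hdeg hK hK' hμ
    haveI : FiniteDimensional K K' := Module.Finite.of_restrictScalars_finite ℚ K K'
    have hsurj : Function.Surjective (algebraMap K K') := fun x => by
      have hx : x ∈ (⊥ : Subalgebra K K') := by
        rw [Subalgebra.bot_eq_top_of_finrank_eq_one (by rw [hdeg, pow_zero])]; exact Algebra.mem_top
      exact Algebra.mem_bot.mp hx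
    let φ : K ≃ₐ[ℚ] K' :=
      AlgEquiv.ofBijective (IsScalarTower.toAlgHom ℚ K K') ⟨(algebraMap K K').injective, hsurj⟩
    exact (classicalMuVanishes_restrict_iff_of_algEquiv κ φ hK hK').mp hμ
  | succ m ih =>
    intro K K' _ _ _ _ _ _ _ _ hdeg hK hK' hμ
    haveI : FiniteDimensional K K' := Module.Finite.of_restrictScalars_finite ℚ K K'
    have hcardG : Nat.card (K' ≃ₐ[K] K') = 2 ^ (m + 1) := by rw [IsGalois.card_aut_eq_finrank, hdeg]
    obtain ⟨H, hH⟩ := Sylow.exists_subgroup_card_pow_prime 2 (n := m) (G := K' ≃ₐ[K] K')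
      (by rw [hcardG]; exact pow_dvd_pow 2 (Nat.le_succ m))
    have hindex : H.index = 2 := by
      have h1 := H.index_mul_card
      rw [hH, hcardG, pow_succ, mul_comm (2 ^ m) 2] at h1
      exact Nat.eq_of_mul_eq_mul_right (pow_pos two_pos m) h1
    haveI : H.Normal := Subgroup.normal_of_index_eq_two hindex
    set M : IntermediateField K K' := IntermediateField.fixedField H with hM
    haveI : NumberField ↥M := NumberField.of_module_finite K ↥M
    haveI : IsScalarTower ℚ K ↥M := IsScalarTower.of_algebraMap_eq' (Subsingleton.elim _ _)
    haveI : IsScalarTower ℚ ↥M K' := IsScalarTower.of_algebraMap_eq' (Subsingleton.elim _ _)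
    haveI : IsGalois ↥M K' := IsGalois.tower_top_of_isGalois K ↥M K'
    haveI : Algebra.IsAlgebraic ↥M K' := Algebra.IsAlgebraic.of_finite ↥M K'
    haveI : IsTotallyReal ↥M := IsTotallyReal.of_algebra ↥M K'
    have hMK' : Module.finrank ↥M K' = 2 ^ m := by rw [hM, IntermediateField.finrank_fixedField_eq_card, hH]
    have hKM : Module.finrank K ↥M = 2 := by
      have h1 := Module.finrank_mul_finrank K ↥M K'
      rw [hMK', hdeg, pow_succ, mul_comm (2 ^ m) 2] at h1
      exact Nat.eq_of_mul_eq_mul_right (pow_pos two_pos m) h1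
    have hMs : Function.Surjective (κ.toContinuousMonoidHom.comp (absGaloisRestrict ℚ ↥M)) :=
      surjective_comp_absGaloisRestrict_of_tower κ ↥M K' hK'
    have hμM : ClassicalMuVanishes (κ.restrict ↥M hMs) :=
      classicalMuVanishes_restrict_rat_of_finrank_eq_two_of_isTotallyReal κ hκ K ↥M hKM hK hMs hμ
    exact ih ↥M K' hMK' hMs hK' hμM

/-! ## §3 Intrinsic forms (every cyclotomic `ℤ₂`-extension) -/

/-- `√2 ∉ K' ⟹ √2 ∉ K` for `K ⊆ K'`. [folklore] -/
private theorem forall_sq_ne_two_of_algebra₂ (K K' : Type) [Field K] [Field K'] [Algebra K K'] (h2 : ∀ y : K', y ^ 2 ≠ 2) :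
    ∀ y : K, y ^ 2 ≠ 2 := fun y hy ↦
  h2 (algebraMap K K' y) (by rw [← map_pow, hy, map_ofNat])

/-- ★★ **Intrinsic form: `μ₂ = 0` for the cyclotomic towers of a TOTALLY COMPLEX `K` ⟹ `μ₂ = 0` for every cyclotomic `ℤ₂`-extension of every
finite GALOIS `2`-POWER extension `K'` of `K` not containing `√2`** (Iwasawa 1973 Thm. 3, `ℓ = 2`).  «`√2 ∉ K'`» makes `K` and `K'` linearly
disjoint from `ℚ_∞` (degree-free criterion `surjective_comp_absGaloisRestrict_of_forall_sq_ne_two'`), so the restricted ascent §2 applies to the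
cyclotomic `ℤ₂`-extension of `ℚ`, and all cyclotomic towers of `K'` share their layers. [cite: Iwasawa1973MuInvariants, Thm. 3 and §4]
[cite: Washington1997, §13.3 Prop. 13.23] -/
theorem classicalMu_of_isGalois_of_finrank_eq_two_pow_of_isTotallyComplex (K K' : Type) [Field K] [NumberField K] [Field K']
    [NumberField K'] [Algebra K K'] [IsGalois K K'] [IsTotallyComplex K] (m : ℕ) (hdeg : Module.finrank K K' = 2 ^ m)
    (h2 : ∀ y : K', y ^ 2 ≠ 2)
    (hμ : ∀ κP : ZpExtension K 2, κP.IsCyclotomic → ClassicalMuVanishes κP) :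
    ∀ κ' : ZpExtension K' 2, κ'.IsCyclotomic → ClassicalMuVanishes κ' := by
  intro κ' hκ'
  haveI : Fact (Nat.Prime 2) := ⟨Nat.prime_two⟩
  haveI : IsScalarTower ℚ K K' := IsScalarTower.of_algebraMap_eq' (Subsingleton.elim _ _)
  obtain ⟨κ, hκ⟩ := exists_cyclotomicZpExtension_holds ℚ 2
  have hK : Function.Surjective (κ.toContinuousMonoidHom.comp (absGaloisRestrict ℚ K)) :=
    surjective_comp_absGaloisRestrict_of_forall_sq_ne_two' κ K hκ (forall_sq_ne_two_of_algebra₂ K K' h2)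
  have hK' : Function.Surjective (κ.toContinuousMonoidHom.comp (absGaloisRestrict ℚ K')) :=
    surjective_comp_absGaloisRestrict_of_forall_sq_ne_two' κ K' hκ h2
  have h1 : ClassicalMuVanishes (κ.restrict K hK) := hμ _ (isCyclotomic_restrict κ hκ K hK)
  have h2' : ClassicalMuVanishes (κ.restrict K' hK') :=
    classicalMuVanishes_restrict_rat_of_isGalois_of_finrank_eq_two_pow_of_isTotallyComplex hκ m K K' hdeg hK hK' h1
  exact (classicalMuVanishes_iff_of_isCyclotomic _ _ (isCyclotomic_restrict κ hκ _ hK') hκ').mp h2'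

/-- ★★ **Intrinsic form, totally real top: `μ₂ = 0` for the cyclotomic towers of `K` ⟹ `μ₂ = 0` for every cyclotomic `ℤ₂`-extension of every
TOTALLY REAL finite Galois `2`-power extension `K'` of `K` not containing `√2`** (Iwasawa 1973 Thm. 2 iterated with archimedean factor `1`).
[cite: Iwasawa1973MuInvariants, Thm. 2 and its proof (pp. 7–8)] [cite: Greenberg1976TotallyReal, §1] [cite: Washington1997, §13.3 Prop. 13.23] -/
theorem classicalMu_of_isGalois_of_finrank_eq_two_pow_of_isTotallyReal (K K' : Type) [Field K] [NumberField K] [Field K']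
    [NumberField K'] [Algebra K K'] [IsGalois K K'] [IsTotallyReal K'] (m : ℕ) (hdeg : Module.finrank K K' = 2 ^ m)
    (h2 : ∀ y : K', y ^ 2 ≠ 2)
    (hμ : ∀ κP : ZpExtension K 2, κP.IsCyclotomic → ClassicalMuVanishes κP) :
    ∀ κ' : ZpExtension K' 2, κ'.IsCyclotomic → ClassicalMuVanishes κ' := by
  intro κ' hκ'
  haveI : Fact (Nat.Prime 2) := ⟨Nat.prime_two⟩
  haveI : IsScalarTower ℚ K K' := IsScalarTower.of_algebraMap_eq' (Subsingleton.elim _ _)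
  obtain ⟨κ, hκ⟩ := exists_cyclotomicZpExtension_holds ℚ 2
  have hK : Function.Surjective (κ.toContinuousMonoidHom.comp (absGaloisRestrict ℚ K)) :=
    surjective_comp_absGaloisRestrict_of_forall_sq_ne_two' κ K hκ (forall_sq_ne_two_of_algebra₂ K K' h2)
  have hK' : Function.Surjective (κ.toContinuousMonoidHom.comp (absGaloisRestrict ℚ K')) :=
    surjective_comp_absGaloisRestrict_of_forall_sq_ne_two' κ K' hκ h2
  have h1 : ClassicalMuVanishes (κ.restrict K hK) := hμ _ (isCyclotomic_restrict κ hκ K hK)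
  have h2' : ClassicalMuVanishes (κ.restrict K' hK') :=
    classicalMuVanishes_restrict_rat_of_isGalois_of_finrank_eq_two_pow_of_isTotallyReal hκ m K K' hdeg hK hK' h1
  exact (classicalMuVanishes_iff_of_isCyclotomic _ _ (isCyclotomic_restrict κ hκ _ hK') hκ').mp h2'

/-- ★★ **`μ₂ = 0` for every TOTALLY REAL Galois number field of `2`-power degree not containing `√2`, and every cyclotomic `ℤ₂`-extension —
fact-free** (base `μ₂(ℚ) = 0`: Iwasawa 1956, tree `classicalMuVanishes_rat`; ascent: Thm. 2 iterated).  E.g. totally real multiquadratic fields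
`ℚ(√a₁, …, √a_r)` (`a_i > 0`, `√2 ∉`), real cyclic quartic / octic fields, the maximal real subfields of `2`-power-conductor-free abelian fields.  For
`K' ∋ √2` (`K' ⊇ ℚ_1`) the tree's currency proviso fails and nothing is claimed. [cite: Iwasawa1973MuInvariants, Thm. 2 and §4]
[cite: Greenberg1976TotallyReal, §1] [cite: Washington1997, §13.3 Prop. 13.23] -/
theorem classicalMuVanishes_of_isGalois_rat_of_finrank_eq_two_pow_of_isTotallyReal (K' : Type) [Field K'] [NumberField K']
    [IsGalois ℚ K'] [IsTotallyReal K'] (m : ℕ) (hdeg : Module.finrank ℚ K' = 2 ^ m) (h2 : ∀ y : K', y ^ 2 ≠ 2)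
    (κ' : ZpExtension K' 2) (hκ' : κ'.IsCyclotomic) : ClassicalMuVanishes κ' := by
  haveI : Fact (Nat.Prime 2) := ⟨Nat.prime_two⟩
  refine classicalMu_of_isGalois_of_finrank_eq_two_pow_of_isTotallyReal ℚ K' m hdeg h2 (fun κP _ ↦ ?_) κ' hκ'
  exact classicalMuVanishes_rat κP

end Literature.NumberTheory.IwasawaTheory

end
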